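import Literature.NumberTheory.EllipticCurves.BigRepLocalTermFiniteCaseProofs
import Literature.NumberTheory.EllipticCurves.JetchevSkinnerWan2017.SigmaLocalCharIdeal
import Literature.NumberTheory.EllipticCurves.PrimaryTorsionContinuousSMulProofs
import Literature.NumberTheory.EllipticCurves.SigmaEulerFactors
import Literature.NumberTheory.GaloisRepresentations.HOneRestrictionOntoInvariantsFinite
import Literature.NumberTheory.GaloisRepresentations.InertiaPadicCharacterProofs
import Literature.NumberTheory.GaloisRepresentations.LocalGaloisGroupProofs
import Literature.NumberTheory.GaloisRepresentations.AbsGaloisGroupCompact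
import Literature.NumberTheory.EllipticCurves.ZpExtensionUnramifiedProofs
import Literature.GroupTheory.FreeProcyclicQuotientRetraction
import HarnessLib

/-!
# The local `Σ`-atom at a FINITELY DECOMPOSED place with FINITE inertia invariants and finite
# `H¹(I_w, E[p^∞])` (the additive places): the three conjuncts, from the finite-case local term

Topic `Literature/NumberTheory/EllipticCurves/JetchevSkinnerWan2017` (sibling of the named LOCAL fact
`sigmaLocal_charIdeal_eulerFactor_mem_of_noTamagawaDefect`). THEOREMS ONLY (no definition, no named fact,
no `sorry`). Cell `bsd-stepL`, K2 support 20495 `JSWSigmaLocalCharIdeal`, module L5; seat `bsd-stepL-imc-p1` g13.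

**`sigmaLocal_of_ne_zero_of_finite_inertia`**: for `E` elliptic over a number field `K : Type`, a prime
`p`, a `ℤ_p`-extension `κ`, a finite place `w ∤ p` with Euler datum `(Nw, t, c)`, `c ≠ 0` (so `w` is
finitely decomposed in `K_∞`), IF the `I_w`-invariants of `E[p^∞]` and `H¹(I_w, E[p^∞])` are finite (both
hold at a place of ADDITIVE reduction, where `(V_pE)^{I_w} = 0`), then the Pontryagin dual `X_w` of
`H¹(K_w, T_pE ⊗ Λ^*(Ψ⁻¹))` is finitely generated and torsion over `Λ` and `Ch_Λ(X_w) = ⊤ ∋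
eulerFactor p ℤ_[p] Nw t c` — the three conjuncts of the atom at `w`. Inputs: the finite-case local term
`BigGaloisRep.moduleFinite_isTorsion_charIdeal_eq_top_dual_h1_bigRep_of_finite` (Greenberg–Vatsal frame
+ counting), `κ(I_w) = 1` (`apply_eq_one_of_mem_absInertia`: `ℤ_p`-extensions are unramified at
`w ∤ p`), `I_w·⟨φ_w⟩` dense in `Γ_{K_w}` (`dense_zpowers_mk_absInertia_of_isFrobPow`,
`dense_mul_zpowers_of_dense`), `I_w` closed hence compact (`isClosed_absInertia_holds`), normal
(`absInertia_normal_holds`).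

HONEST FRAMING: the two finiteness hypotheses are NOT discharged here (tree: the additive case of
Silverman *ATAEC* IV.10.2(a), `codimFixed_inertia_rationalTate_eq_two_of_hasAdditiveReductionAt`, is in
the rational-Tate-module currency); the good ∕ multiplicative finitely decomposed places are NOT covered
(infinite `E[p^∞]^{I_w}`; they need the `Λ`-structure route of `HOME/imc-p1/g13/L5-PLAN`).

References: [GreenbergVatsal2000] Prop. 2.4; [Skinner2016PacificMC] §2.3; [JetchevSkinnerWan2017] proof of
Thm. 6.1.6; [SerreLocalFields1979] XIII §1; [Washington1997] Prop. 13.2 (ℤ_p-extensions unramified outside p).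
-/

noncomputable section

open scoped Classical Pointwise

open Field NumberField IsDedekindDomain WeierstrassCurve Multiplicative
open Literature.NumberTheory.EllipticCurves Literature.NumberTheory.GaloisRepresentations
  Literature.NumberTheory.EllipticCurves.BigGaloisRep Literature.NumberTheory.EllipticCurves.IwasawaCharacter

namespace Literature.NumberTheory.EllipticCurves.JetchevSkinnerWan2017

/-- **The local `Σ`-atom at a finitely decomposed place with finite `E[p^∞]^{I_w}` and finite
`H¹(I_w, E[p^∞])`** (the ADDITIVE places): the Pontryagin dual of `H¹(K_w, T_pE ⊗ Λ^*(Ψ⁻¹))` is finitely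
generated and torsion over `Λ`, with characteristic ideal `⊤` — so it contains `eulerFactor p ℤ_[p] Nw t c`
(the three conjuncts of `sigmaLocal_charIdeal_eulerFactor_mem_of_noTamagawaDefect` at `w`).
[cite: GreenbergVatsal2000, Prop. 2.4] [cite: Skinner2016PacificMC, §2.3 (p. 180)]
[cite: JetchevSkinnerWan2017, proof of Thm. 6.1.6 (local display)] [cite: Washington1997, Prop. 13.2] -/
theorem sigmaLocal_of_ne_zero_of_finite_inertia {K : Type} [Field K] [NumberField K]
    (E : WeierstrassCurve K) [E.IsElliptic] (p : ℕ) [Fact p.Prime] (κ : ZpExtension K p)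
    (w : HeightOneSpectrum (𝓞 K)) (hw : ((p : ℕ) : 𝓞 K) ∉ w.asIdeal)
    (Nw : ℕ) (t : LocalReductionData) (c : ℤ_[p]) (hdata : IsEulerDataAt E κ w Nw t c) (hc : c ≠ 0)
    [ContinuousSMul ℤ_[p] (PrimaryTorsion (geomPoints E) p)]
    (hfinI : Set.Finite {a : PrimaryTorsion (geomPoints E) p |
      ∀ σ ∈ absInertia (w.adicCompletion K), (E.primaryTorsionGaloisRep p) (localMap K (Sum.inl w) σ) a = a})
    (hfinH : Finite (continuousCohomology 1 (subgroupRep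
      (((E.primaryTorsionGaloisRep p).restrict (localMap K (Sum.inl w)) :
        ContinuousRep (absoluteGaloisGroup (w.adicCompletion K)) ℤ_[p]
          (PrimaryTorsion (geomPoints E) p))).toTopRep
        (absInertia (w.adicCompletion K)))))
    [TopologicalSpace (IwasawaAlgebra p)]
    [ContinuousSMul (IwasawaAlgebra p) (BigRepModule ℤ_[p] p (PrimaryTorsion (geomPoints E) p))] :
    Module.Finite (IwasawaAlgebra p) (CharacterModule (continuousCohomology 1
        ((AnticyclotomicBigGaloisRep κ (E.primaryTorsionGaloisRep p)).restrict
          (localMap K (Sum.inl w))).toTopRep)) ∧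
      Module.IsTorsion (IwasawaAlgebra p) (CharacterModule (continuousCohomology 1
        ((AnticyclotomicBigGaloisRep κ (E.primaryTorsionGaloisRep p)).restrict
          (localMap K (Sum.inl w))).toTopRep)) ∧
      eulerFactor p ℤ_[p] Nw t c ∈ Module.charIdeal (IwasawaAlgebra p) (CharacterModule
        (continuousCohomology 1
          ((AnticyclotomicBigGaloisRep κ (E.primaryTorsionGaloisRep p)).restrict
            (localMap K (Sum.inl w))).toTopRep)) := by
  haveI : CompactSpace (absoluteGaloisGroup (w.adicCompletion K)) :=
    absoluteGaloisGroup_compactSpace (w.adicCompletion K)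
  haveI : CompactSpace (LocalGroup K (Sum.inl w)) := absoluteGaloisGroup_compactSpace (w.adicCompletion K)
  haveI hnormal : (absInertia (w.adicCompletion K)).Normal := absInertia_normal_holds (w.adicCompletion K)
  haveI : CompactSpace (absInertia (w.adicCompletion K)) :=
    isCompact_iff_compactSpace.mp (isClosed_absInertia_holds (w.adicCompletion K)).isCompact
  set κw : absoluteGaloisGroup (w.adicCompletion K) →ₜ* Multiplicative ℤ_[p] :=
    κ.toContinuousMonoidHom.comp (localMap K (Sum.inl w)) with hκw
  set ρw : ContinuousRep (absoluteGaloisGroup (w.adicCompletion K)) ℤ_[p] (PrimaryTorsion (geomPoints E) p) :=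
    (E.primaryTorsionGaloisRep p).restrict (localMap K (Sum.inl w)) with hρw
  -- the Frobenius of the Euler datum: `κ(φ) = c ≠ 0`, `I_w·⟨φ⟩` dense
  obtain ⟨-, ⟨φ, hφ, hκφ⟩, -⟩ := hdata
  have hψ : (κw φ).toAdd ≠ 0 := by
    change (κ (localMap K (Sum.inl w) φ)).toAdd ≠ 0
    rw [hκφ]; exact hc
  have hdense : Dense (((absInertia (w.adicCompletion K)) :
      Set (absoluteGaloisGroup (w.adicCompletion K))) *
        (Subgroup.zpowers φ : Set (absoluteGaloisGroup (w.adicCompletion K)))) :=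
    Literature.GroupTheory.dense_mul_zpowers_of_dense _ φ
      (dense_zpowers_mk_absInertia_of_isFrobPow (w.adicCompletion K) hφ)
  -- `κ(I_w) = 1`
  have hκN : ∀ n ∈ absInertia (w.adicCompletion K), κw n = 1 := fun n hn =>
    apply_eq_one_of_mem_absInertia (w.ringChar_residueField_adicCompletion_ne hw) κw hn
  -- `E[p^∞]` is `p`-primary; its `I_w`-invariants and `H¹(I_w, E[p^∞])` are finite by hypothesis
  have hA : ∀ a : PrimaryTorsion (geomPoints E) p, ∃ k : ℕ, p ^ k • a = 0 := fun a =>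
    (a.exists_pow_smul_eq_zero).imp fun k hk =>
      PrimaryTorsion.ext (by rw [PrimaryTorsion.val_nsmul, hk, PrimaryTorsion.val_zero])
  haveI : Finite (ρw.invariantsOf (absInertia (w.adicCompletion K))) := by
    haveI := hfinI.to_subtype
    refine Finite.of_injective (fun a : ρw.invariantsOf (absInertia (w.adicCompletion K)) =>
      (⟨a.1, fun σ hσ => ?_⟩ : {a : PrimaryTorsion (geomPoints E) p |
        ∀ σ ∈ absInertia (w.adicCompletion K),
          (E.primaryTorsionGaloisRep p) (localMap K (Sum.inl w) σ) a = a})) ?_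
    · exact (ρw.mem_invariantsOf_iff _ a.1).mp a.2 ⟨σ, hσ⟩
    · intro a b h; exact Subtype.ext (by simpa using congrArg Subtype.val h)
  haveI := hfinH
  -- the finite-case local term for `bigRep κw ρw = M|_{Γ_{K_w}}`
  obtain ⟨hfg, htors, hCh⟩ :=
    moduleFinite_isTorsion_charIdeal_eq_top_dual_h1_bigRep_of_finite κw ρw (absInertia (w.adicCompletion K))
      hκN hψ hdense hA
  rw [show (AnticyclotomicBigGaloisRep κ (E.primaryTorsionGaloisRep p)).restrict (localMap K (Sum.inl w)) =
      bigRep κw ρw from bigRep_restrict _ _ _]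
  exact ⟨hfg, htors, hCh ▸ Submodule.mem_top⟩

end Literature.NumberTheory.EllipticCurves.JetchevSkinnerWan2017

end
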